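import Summits.QuantumFields.YangMills.Theorems.BalabanUVNodesN22W1StripInductionLetters
import Literature.MathematicalPhysics.QuantumFieldTheory.Balaban1983to89.B13Lemma3TorusSocket

/-!
# BalabanUVNodes ∕ node N22 = NE9 — THE STRIP INDUCTION AT THE W1 OBJECT, MODULE 3: LEMMA 3's RESUMMATION (2.26) ⇒ (2.38) ON THE
# YOUNG-COUPLING STRIP BY NAME (`B13Lemma3TorusSocket` at a two-torus step whose «configuration» IS the strip parameter), so that the ONE
# displayed one-step hypothesis of the induction drops to print's «by assertion» analytic content (2.15)–(2.26) PER TERM (𝐃, P), read on the strip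

Cell `pub-ymgap`, HUMAN RULING D-0062 (Track A), R134 ACCELERATION re-seat `pub-ymgap-dag-n22-c` (strategy s1: «the history-Lipschitz estimate
(2.40)–(2.41) p. 21 of [II] on the W1 object»), generation 2, module 3.  THEOREMS ONLY; imports module 2 `…N22W1StripInductionLetters` (p463776;
through it module 1 p462912, generation 0's modules, S25 and the W1 OBJECT p455641) and the Literature socket `B13Lemma3TorusSocket` (`HRep`,
`Lemma3Numerics`, `h238_of_hRep_half`, `hRep_of_termwise` — the kernel-checked torus chain `B13Lemma3Torus.bound238With_torus` ⇐
`B13Lemma3TorusTerms.hrep_of_termwise` of [II] pp. 17–20) BY NAME.  `--supports` the K3 item of route `BalabanUVNodes`.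

WHY.  Module 1's displayed one-step hypothesis `hprop` asks, on the strip, for complexified terms under the RESUMMED (2.26)-majorant `A·e^{−R d}` —
i.e. it folds Lemma 3's resummation (2.28)–(2.37) into the hypothesis.  But that resummation is COUPLING-BLIND and CONFIGURATION-BLIND: the tree's
torus engine consumes two-torus step data `TwoTorusStep 4 L N′` whose configuration type `Φ` is ABSTRACT (generation 0's remark «the strip version is
the SAME theorem at complexified term data»).  Taking `Φ := ℂ` — the strip parameter `z` as the configuration —, `sp2 Z := {z ∈ O | Z ⊆ X}` and `H Z z :=
Hc z Z` (the complexified activity), the socket's `h238_of_hRep_half` ∕ `hRep_of_termwise` turn «(2.26) on the strip» into «(2.38) on the strip» AS A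
KERNEL THEOREM at the printed transfer factor `ℓ = ½L`, `L ≥ 8` ((2.36) = `ineq236Printed_torus`), under the socket's ONE numerics bundle
`Lemma3Numerics` (the printed restrictions on the constants, n- and k-uniform; non-vacuous: `B13Lemma3TorusNonvacuity.numerics_nonvacuous`).
After this module the displayed one-step hypothesis of N22's strip induction at the W1 object is print's «by assertion» analytic content ALONE:
(2.15)–(2.26) FOR EVERY TERM (𝐃, P) of the printed term set `B13Lemma3TorusTerms.terms L M Z`, with the printed weight
`B13Lemma3TorusTerms.weight` ((2.26) p. 17), READ ON THE STRIP of one young coupling (level T), or its resummed-index form `HRep` (level R);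
Lemma 3's resummation, (2.39)–(2.41), the induction on the level and the letters are kernel theorems (this module, S25, modules 1–2).

WHAT (STRIP(j, i; E₀, κ) as in module 1; `N′ := domCount (F.P K) M (k+1)` = cubes of `𝐃_{k+1}` per direction; the fine torus `tsys 4 (L·N′)` of the
(2.26)-weights is `𝐃_k` of record under exact tiling, `Sect2FrameOfRecord` (ℓ1)).
* §1 `strip_succ_of_complexifiedActivities` — module 1's pointwise step at ACTIVITY level: `Hc` holomorphic on an open `O ⊇` the discs polymer by
  polymer inside `X`, `‖Hc z Z‖ ≤ A·e^{−R d(Z)}`, `Hc t = (S k).H (g|g_i:=t)|_{≤k} φ` ⟹ STRIP(k+1, i) (S25 BY NAME; generation 0's `youngHolo` datum at one point).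
* §2 `strip_succ_of_stripStepHRep` — THE ENGINE: the two-torus STRIP STEP (`Φ := ℂ`, `sp2 Z := {z ∈ O | Z ⊆ X}`, `H Z z := Hc z Z`, all other fields
  inert) + `HRep c M a a₅` for it + `Lemma3Numerics c M (½L) …` + `8 ≤ L` ⟹ `‖Hc z Z‖ ≤ C₃ε₁·e^{−(1−8δ)½Lκ·d(Z)}` on the strip (socket
  `h238_of_hRep_half` BY NAME) ⟹ STRIP(k+1, i) by §1 with `A := C₃ε₁` (`c.C3act * c.ε₁`), `R := (1−8δ)½Lκ`, S25's numerals at these letters and the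
  renewal `e·9·64·K₀(64,8)²·C₃ε₁ ≤ E₀` (print's R23 `O(1)C₃ε₁ ≤ ½E₀` with the tree's O(1)); `strip_succ_of_hRepStrip` — LEVEL R: the same with the
  `HRep` inequality DISPLAYED explicitly for `Hc` on the strip; `strip_succ_of_termwise226Strip` — LEVEL T: complexified term values `Tt Z t z` indexed
  by print's term set `terms L M Z` dominating `Hc` (`‖Hc z Z‖ ≤ Σ_t ‖Tt Z t z‖`, (2.9)∕(2.14)) and obeying (2.26) PER TERM on the strip (`‖Tt Z t z‖ ≤
  weight(t)·e^{a₅|Z|}`) ⟹ STRIP(k+1, i) (socket `hRep_of_termwise` BY NAME).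
* §3 `stepOut_of_termwise226Strip` — the displayed LEVEL-T one-step hypothesis «STRIP at levels ≤ k in coupling i ⇒ such `(Hc, Tt, O)`» ⟹ module 1's
  one-step output hypothesis; END TO END: `stripBound_termC_of_termwise226Strip` (STRIP everywhere), `termBound118_of_termwise226Strip` ((1.18) one
  run), `supLetter_functionalOn_of_termwise226Strip` (ROAD 3's (A) letter `E₀·1^{age}·e^{−κd}`, module 2 §1); `stepOut_of_hRepStrip` (level R).
* §4 `termwise226Strip_termlessTower` — NON-VACUITY (A5 rider): the termless model tower carries the level-T hypothesis with `Hc ≡ 0`, `Tt ≡ 0`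
  (`weight_nonneg`; model tower, NOT NODE 00's — junk-shaped per ref-H WATCH-W1-DEGENERATE, labelled so).

HONEST FRAMING.  Count-neutral by-name knit AT THE OBJECT; NOT a discharge of N22.  The level-T∕R hypotheses are DISPLAYED and asserted nowhere: they
are [II] (2.15)–(2.26) with the old terms replaced by their strip extensions in ONE young coupling (NOT PRINTED as such; inspection-level for the
OLDER couplings — `g_i`, `i < k`, is read through the old terms only, [II] (2.15) p. 15 —, [H-dil] ∕ [I] p. 266–267 content for the LAST); the term
VALUES `Tt` are data of the hypothesis (the W1 object's own index sets are abstract; pinning them to print's (𝐃, P) is ref-H's WATCH, served here by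
indexing the domination by `terms L M Z` itself); the fine torus of the weights is `𝐃_k` of record only under exact tiling (ℓ1).  Every constant
restriction used is the socket's printed list (`Lemma3Numerics`) + S25's two located clauses + the renewal.  NE9 NOT IN PRINT, NOT PROVED; one finite
four-torus programme at fixed ε — NOT infinite volume, NOT OS on ℝ⁴, NOT a mass gap, NOT Clay.  0 `sorry`, 0 `def`, standard axioms.

References (TYPES only): [I] = [Balaban1987RG1] T. Bałaban, Commun. Math. Phys. **109** (1987) 249–301 — (1.18) p. 263, p. 266–267; [II] =
[Balaban1988RG2Cluster] T. Bałaban, Commun. Math. Phys. **116** (1988) 1–22 — (2.9)–(2.15) pp. 14–15, (2.26) p. 17, pp. 17–20 (resummation), (2.36)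
p. 19, Lemma 3 (2.38) p. 20, (2.39)–(2.41) p. 21, R23 p. 21; [KoteckyPreiss1986] Thm p. 492.
-/

noncomputable section

namespace YMDAG.N22.W1

open Set Metric
open scoped BigOperators
open Literature.MathematicalPhysics.QuantumFieldTheory.Balaban1983to89
open Literature.MathematicalPhysics.QuantumFieldTheory.Balaban1983to89.T4Continuum (T4Family)
open Literature.MathematicalPhysics.QuantumFieldTheory.Balaban1983to89.T4OutputRate
open Literature.MathematicalPhysics.QuantumFieldTheory.Balaban1983to89.B13Resummation (locE)
open Literature.MathematicalPhysics.QuantumFieldTheory.Balaban1983to89.TreeLengthTorus (TPt TDom tsys torusTreeLen torusTreeLen_nonneg)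
open Literature.MathematicalPhysics.QuantumFieldTheory.Balaban1983to89.TreeLengthTorusGeometry (TTouch)
open Literature.MathematicalPhysics.QuantumFieldTheory.Balaban1983to89.TreeLengthTorusTransfer (tclosureDom)
open Literature.MathematicalPhysics.QuantumFieldTheory.Balaban1983to89.B12TreeDecay (K₀ K₀_pos)
open Literature.MathematicalPhysics.QuantumFieldTheory.Balaban1983to89.B13Lemma3TorusData (TBond ttouch tavail)
open Literature.MathematicalPhysics.QuantumFieldTheory.Balaban1983to89.B13Lemma3Assembly (innerSum compSum famSum)
open Literature.MathematicalPhysics.QuantumFieldTheory.Balaban1983to89.B13Lemma3Torus (TwoTorusStep J I wZ cc)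
open Literature.MathematicalPhysics.QuantumFieldTheory.Balaban1983to89.B13Lemma3TorusTerms (terms weight weight_nonneg)
open Literature.MathematicalPhysics.QuantumFieldTheory.Balaban1983to89.B13Lemma3TorusSocket (HRep Lemma3Numerics h238_of_hRep_half hRep_of_termwise)
open Literature.MathematicalPhysics.QuantumFieldTheory.Balaban1983to89.Node00
open Literature.MathematicalPhysics.QuantumFieldTheory.Balaban1983to89.Node00.Sect2 (domSys domCount CPair ofBackgroundC)
open Literature.MathematicalPhysics.QuantumFieldTheory.Balaban1983to89.Node00.W1
open Summit.QuantumFields.BalabanUV.T4Continuum.NE1p.DressedOutputAnalyticFaces (analytic_and_bounded_locE_param_torus)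

variable (F : T4Family) (K : ℕ) {𝔸 : Type*} {M : ℕ}

/-! ## §1 Module 1's pointwise step at activity level -/

open Classical in
/-- **ONE STEP AT ONE POINT, ACTIVITY LEVEL** (generation 0's `youngHolo` datum at one `(k, g, i, X, φ)`): a complexified activity family `Hc`,
holomorphic on an open `O ⊇` the closed `r`-discs about `]0, γ]` polymer by polymer inside `X`, with `‖Hc z Z‖ ≤ A·e^{−R·d_{k+1}(Z)}` on `O` and
`Hc t = (S k).H (g | g_i := t)|_{≤k} φ` at real `t`, gives STRIP(k+1, i) at `(g, X, φ)` under S25's located numerals and the renewal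
`e·9·64·K₀(64,8)²·A ≤ E₀` — S25 `analytic_and_bounded_locE_param_torus` BY NAME, (2.13) definitional in W1. [folklore] -/
theorem strip_succ_of_complexifiedActivities (S : ClusterTower (F.P K) 𝔸 M) {γ r E₀ κ A R r₁ : ℝ} (hA0 : 0 ≤ A) (hr₁ : 0 ≤ r₁) (hκ : κ ≤ r₁)
    (hrate : r₁ + 2 * (64 * Real.log 162) + 2 ≤ R) (hsmall : A * Real.exp (5 * r₁ + 1) * K₀ 64 8 * 9 * 64 ≤ 1)
    (hrenew : Real.exp 1 * 9 * 64 * K₀ 64 8 ^ 2 * A ≤ E₀) (k : ℕ) (g : ℕ → ℝ) (i : ℕ) (X : (domSys (F.P K) M (k + 1)).Dom)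
    (φ : CPair (F.P K) 𝔸) (Hc : ℂ → (domSys (F.P K) M (k + 1)).Dom → ℂ) (O : Set ℂ) (hO : IsOpen O)
    (hdisc : ∀ t ∈ Ioc (0 : ℝ) γ, closedBall (t : ℂ) r ⊆ O)
    (hhol : ∀ Z : (domSys (F.P K) M (k + 1)).Dom, Z.1 ⊆ X.1 → DifferentiableOn ℂ (fun z => Hc z Z) O)
    (hmaj : ∀ z ∈ O, ∀ Z : (domSys (F.P K) M (k + 1)).Dom, Z.1 ⊆ X.1 → ‖Hc z Z‖ ≤ A * Real.exp (-(R * torusTreeLen Z.1)))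
    (hrepH : ∀ t ∈ Ioc (0 : ℝ) γ, Hc t = (S k).H (restrictPrefix k (Function.update g i t)) φ) :
    ∃ (Ec : ℂ → ℂ) (O : Set ℂ), IsOpen O ∧ (∀ t ∈ Ioc (0 : ℝ) γ, closedBall (t : ℂ) r ⊆ O) ∧ DifferentiableOn ℂ Ec O ∧
      (∀ z ∈ O, ‖Ec z‖ ≤ E₀ * Real.exp (-(κ * torusTreeLen X.1))) ∧
      (∀ t ∈ Ioc (0 : ℝ) γ, Ec t = termC S (k + 1) X (Function.update g i t) φ) := by
  have key := analytic_and_bounded_locE_param_torus (N := domCount (F.P K) M (k + 1)) (P := ℂ)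
    (m := fun Z : (tsys 4 (domCount (F.P K) M (k + 1))).Dom => A * Real.exp (-(R * torusTreeLen Z.1)))
    (act := Hc) (A := A) (R := R) (r₁ := r₁) X hO hA0 hr₁ hrate hsmall hhol (fun z hz Z hZ => hmaj z hz Z hZ) (fun Z _ => le_rfl)
  have hM : 0 ≤ Real.exp 1 * 9 * 64 * K₀ 64 8 ^ 2 * A := by positivity
  refine ⟨fun z => locE (TTouch (d := 4) (N := domCount (F.P K) M (k + 1)))
      (fun Z : (tsys 4 (domCount (F.P K) M (k + 1))).Dom => Z.1) (Hc z) X.1,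
    O, hO, hdisc, key.1, fun z hz => ?_, fun t ht => ?_⟩
  · calc ‖locE (TTouch (d := 4) (N := domCount (F.P K) M (k + 1))) (fun Z : (tsys 4 (domCount (F.P K) M (k + 1))).Dom => Z.1)
            (Hc z) X.1‖
        ≤ Real.exp 1 * 9 * 64 * K₀ 64 8 ^ 2 * A * Real.exp (-(r₁ * torusTreeLen X.1)) := key.2 z hz
      _ ≤ E₀ * Real.exp (-(κ * torusTreeLen X.1)) :=
          mul_le_mul hrenew (Real.exp_le_exp.2 (neg_le_neg (mul_le_mul_of_nonneg_right hκ (torusTreeLen_nonneg _))))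
            (Real.exp_nonneg _) (le_trans hM hrenew)
  · exact (congrArg (fun w : TDom 4 (domCount (F.P K) M (k + 1)) → ℂ =>
      locE (TTouch (d := 4) (N := domCount (F.P K) M (k + 1)))
        (fun Z : (tsys 4 (domCount (F.P K) M (k + 1))).Dom => Z.1) w X.1) (hrepH t ht)).trans rfl

/-! ## §2 Lemma 3's resummation on the strip: the two-torus STRIP STEP and the socket by name -/

open Classical in
/-- **THE ENGINE: THE STRIP STEP.**  At a fixed `(k, g, i, X, φ)` with complexified activities `Hc` on an open `O`, the two-torus step data with
CONFIGURATION TYPE `Φ := ℂ` (the strip parameter), space `sp2 Z := {z ∈ O | Z ⊆ X}`, activity `H Z z := Hc z Z` and every other field inert (they are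
not read by Lemma 3) make «(2.26) in resummed-index form on the strip» LITERALLY the socket's `HRep c M a a₅` for that step; the socket's
`h238_of_hRep_half` (Lemma 3's resummation pp. 17–20 kernel-checked on the torus, (2.36) = `ineq236Printed_torus` at `ℓ = ½L`, `L ≥ 8`, the printed
restrictions bundled as `Lemma3Numerics`) returns `‖Hc z Z‖ ≤ C₃ε₁·e^{−(1−8δ)½Lκ d_{k+1}(Z)}` for `z ∈ O`, `Z ⊆ X` — (2.38) ON THE STRIP — and §1 closes
STRIP(k+1, i) with `A := C₃ε₁`, `R := (1−8δ)½Lκ`. [cite: Balaban1988RG2Cluster, Lemma 3 (2.38) p.20 (read on the strip)] -/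
theorem strip_succ_of_stripStepHRep [NeZero M] (S : ClusterTower (F.P K) 𝔸 M) (c : B13.Consts) {L : ℕ} [NeZero L] (hL : 8 ≤ c.L)
    (hLc : c.L = L) {a a₂ a₂' a₅ Aabs : ℝ} (hN : Lemma3Numerics c M ((c.L : ℝ) / 2) a a₂ a₂' a₅ Aabs)
    {γ r E₀ κ r₁ : ℝ} (hA0 : 0 ≤ c.C3act * c.ε₁) (hr₁ : 0 ≤ r₁) (hκ : κ ≤ r₁)
    (hrate : r₁ + 2 * (64 * Real.log 162) + 2 ≤ (1 - 8 * c.δ) * ((c.L : ℝ) / 2) * c.κ)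
    (hsmall : c.C3act * c.ε₁ * Real.exp (5 * r₁ + 1) * K₀ 64 8 * 9 * 64 ≤ 1)
    (hrenew : Real.exp 1 * 9 * 64 * K₀ 64 8 ^ 2 * (c.C3act * c.ε₁) ≤ E₀) (k : ℕ) (g : ℕ → ℝ) (i : ℕ)
    (X : (domSys (F.P K) M (k + 1)).Dom) (φ : CPair (F.P K) 𝔸) (Hc : ℂ → TDom 4 (domCount (F.P K) M (k + 1)) → ℂ) (O : Set ℂ)
    (hO : IsOpen O) (hdisc : ∀ t ∈ Ioc (0 : ℝ) γ, closedBall (t : ℂ) r ⊆ O)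
    (hhol : ∀ Z : (domSys (F.P K) M (k + 1)).Dom, Z.1 ⊆ X.1 → DifferentiableOn ℂ (fun z => Hc z Z) O)
    (hrep : HRep c M a a₅
      ({ volk := fun _ => 0, Φ := ℂ, Bond := PUnit, sp1 := fun _ => ∅, sp2 := fun Z => {z | z ∈ O ∧ Z.1 ⊆ X.1},
         Bv := fun _ _ => 0, Vp := fun _ _ => 0, V := fun _ _ => 0, Q := fun _ _ _ _ => 0, Vpp := fun _ _ => 0,
         H := fun Z z => Hc z Z, Ek1 := fun _ _ => 0, Elog := fun _ _ => 0, Analytic := fun _ _ => True,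
         GaugeInv := fun _ => True, Repr17 := True, Restr := True } : TwoTorusStep 4 L (domCount (F.P K) M (k + 1))))
    (hrepH : ∀ t ∈ Ioc (0 : ℝ) γ, Hc t = (S k).H (restrictPrefix k (Function.update g i t)) φ) :
    ∃ (Ec : ℂ → ℂ) (O : Set ℂ), IsOpen O ∧ (∀ t ∈ Ioc (0 : ℝ) γ, closedBall (t : ℂ) r ⊆ O) ∧ DifferentiableOn ℂ Ec O ∧
      (∀ z ∈ O, ‖Ec z‖ ≤ E₀ * Real.exp (-(κ * torusTreeLen X.1))) ∧
      (∀ t ∈ Ioc (0 : ℝ) γ, Ec t = termC S (k + 1) X (Function.update g i t) φ) := by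
  -- Lemma 3 on the strip: the socket at the strip step (a constant family over a dummy index)
  -- (the strip step is read off the type of `hrep`)
  have h238 := h238_of_hRep_half c hL hLc (N' := fun _ : ℕ => domCount (F.P K) M (k + 1)) (fun _ => _) M hN
    (fun _ => hrep) 0
  refine strip_succ_of_complexifiedActivities F K S hA0 hr₁ hκ hrate hsmall hrenew k g i X φ Hc O hO hdisc hhol
    (fun z hz Z hZ => ?_) hrepH
  exact h238 Z z ⟨hz, hZ⟩

open Classical in
/-- **LEVEL R: (2.26) IN RESUMMED-INDEX FORM ON THE STRIP ⟹ STRIP(k+1, i).**  The `HRep` inequality DISPLAYED for the complexified activity: for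
`z ∈ O` and `Z ⊆ X`, `‖Hc z Z‖ ≤ e^{a₅|Z|}·Σ_{Z′₀ ⊆ Z, Z′₀ ≠ ∅} e^{−(κ₁−1)|Z∖Z′₀|}·Π_{torus components Z′_i} famSum Π compSum Π innerSum` with the
(2.26)-weights `α₆ε₂e^{−(1−3δ)κ d_k(Y)}`, `e^{−(a∕2)|P|}` over the CONCRETE torus index sets of `B13Lemma3Torus` (`J`, `I`, `wZ`, `cc`, `tclosureDom`,
`ttouch`, `tavail`; fine torus `tsys 4 (L·N′)`, `N′ = domCount (F.P K) M (k+1)`) — NOT PRINTED on the strip; print's (2.15)–(2.26) by assertion at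
real couplings — ⟹ STRIP(k+1, i), by the engine. [cite: Balaban1988RG2Cluster, (2.26) p.17 and pp.17–20 (resummation order)] -/
theorem strip_succ_of_hRepStrip [NeZero M] (S : ClusterTower (F.P K) 𝔸 M) (c : B13.Consts) {L : ℕ} [NeZero L] (hL : 8 ≤ c.L)
    (hLc : c.L = L) {a a₂ a₂' a₅ Aabs : ℝ} (hN : Lemma3Numerics c M ((c.L : ℝ) / 2) a a₂ a₂' a₅ Aabs)
    {γ r E₀ κ r₁ : ℝ} (hA0 : 0 ≤ c.C3act * c.ε₁) (hr₁ : 0 ≤ r₁) (hκ : κ ≤ r₁)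
    (hrate : r₁ + 2 * (64 * Real.log 162) + 2 ≤ (1 - 8 * c.δ) * ((c.L : ℝ) / 2) * c.κ)
    (hsmall : c.C3act * c.ε₁ * Real.exp (5 * r₁ + 1) * K₀ 64 8 * 9 * 64 ≤ 1)
    (hrenew : Real.exp 1 * 9 * 64 * K₀ 64 8 ^ 2 * (c.C3act * c.ε₁) ≤ E₀) (k : ℕ) (g : ℕ → ℝ) (i : ℕ)
    (X : (domSys (F.P K) M (k + 1)).Dom) (φ : CPair (F.P K) 𝔸) (Hc : ℂ → TDom 4 (domCount (F.P K) M (k + 1)) → ℂ) (O : Set ℂ)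
    (hO : IsOpen O) (hdisc : ∀ t ∈ Ioc (0 : ℝ) γ, closedBall (t : ℂ) r ⊆ O)
    (hhol : ∀ Z : (domSys (F.P K) M (k + 1)).Dom, Z.1 ⊆ X.1 → DifferentiableOn ℂ (fun z => Hc z Z) O)
    (h226 : ∀ z ∈ O, ∀ Z : TDom 4 (domCount (F.P K) M (k + 1)), Z.1 ⊆ X.1 → ‖Hc z Z‖ ≤
      Real.exp (a₅ * ((Z.1).card : ℝ)) *
      ∑ j₀ : J Z, Real.exp (-((c.κ₁ - 1) * ((wZ Z j₀).card : ℝ))) *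
        ∏ i₀ : I Z j₀, famSum (B13FamilySum.coveringFamilies (Finset.univ : Finset (TDom 4 (domCount (F.P K) M (k + 1))))
            (fun Z' : TDom 4 (domCount (F.P K) M (k + 1)) => Z'.1) (cc Z j₀ i₀))
          (fun Z' => compSum (Finset.univ.filter fun Zc : TDom 4 (L * domCount (F.P K) M (k + 1)) =>
              tclosureDom L (domCount (F.P K) M (k + 1)) Zc = Z')
            (fun Zc => innerSum (Finset.univ : Finset (TDom 4 (L * domCount (F.P K) M (k + 1))))
              (fun Y : TDom 4 (L * domCount (F.P K) M (k + 1)) => Y.1) (tsys 4 (L * domCount (F.P K) M (k + 1))).dj Zc.1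
              (ttouch M (L * domCount (F.P K) M (k + 1))) (tavail M (L * domCount (F.P K) M (k + 1)) Zc)
              (c.α₆ * c.eps2) ((1 - 3 * c.δ) * c.κ) a)))
    (hrepH : ∀ t ∈ Ioc (0 : ℝ) γ, Hc t = (S k).H (restrictPrefix k (Function.update g i t)) φ) :
    ∃ (Ec : ℂ → ℂ) (O : Set ℂ), IsOpen O ∧ (∀ t ∈ Ioc (0 : ℝ) γ, closedBall (t : ℂ) r ⊆ O) ∧ DifferentiableOn ℂ Ec O ∧
      (∀ z ∈ O, ‖Ec z‖ ≤ E₀ * Real.exp (-(κ * torusTreeLen X.1))) ∧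
      (∀ t ∈ Ioc (0 : ℝ) γ, Ec t = termC S (k + 1) X (Function.update g i t) φ) :=
  strip_succ_of_stripStepHRep F K S c hL hLc hN hA0 hr₁ hκ hrate hsmall hrenew k g i X φ Hc O hO hdisc hhol
    (fun Z z hz => h226 z hz.1 Z hz.2) hrepH

open Classical in
/-- **LEVEL T: (2.26) FOR EVERY TERM (𝐃, P) ON THE STRIP ⟹ STRIP(k+1, i).**  Complexified term values `Tt Z t z` indexed by print's term set
`terms L M Z` (pairs `(𝐃 ⊂ 𝐃_k, P)`, [II] (2.9)∕(2.14)) DOMINATING the complexified activity on the strip, `‖Hc z Z‖ ≤ Σ_{t ∈ terms L M Z} ‖Tt Z t z‖`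
(`z ∈ O`, `Z ⊆ X`), each obeying (2.26) p. 17 with the printed weight, `‖Tt Z t z‖ ≤ weight(t)·e^{a₅|Z|}` (`B13Lemma3TorusTerms.weight` =
`e^{−(κ₁−1)|Z∖Z′₀|}·Π_{Y∈𝐃} α₆ε₂e^{−(1−3δ)κ d_k(Y)}·e^{−(a∕2)|P|}`) — DISPLAYED: print's «by assertion» analytic content (2.15)–(2.26) READ ON THE STRIP of
the `i`-th coupling — ⟹ STRIP(k+1, i): socket `hRep_of_termwise` (the printed resummation ORDER p. 17 as an injection of the term set) then the engine.
[cite: Balaban1988RG2Cluster, (2.26) p.17 (read on the strip)] -/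
theorem strip_succ_of_termwise226Strip [NeZero M] (S : ClusterTower (F.P K) 𝔸 M) (c : B13.Consts) {L : ℕ} [NeZero L] (hL : 8 ≤ c.L)
    (hLc : c.L = L) {a a₂ a₂' a₅ Aabs : ℝ} (hN : Lemma3Numerics c M ((c.L : ℝ) / 2) a a₂ a₂' a₅ Aabs)
    {γ r E₀ κ r₁ : ℝ} (hA0 : 0 ≤ c.C3act * c.ε₁) (hr₁ : 0 ≤ r₁) (hκ : κ ≤ r₁)
    (hrate : r₁ + 2 * (64 * Real.log 162) + 2 ≤ (1 - 8 * c.δ) * ((c.L : ℝ) / 2) * c.κ)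
    (hsmall : c.C3act * c.ε₁ * Real.exp (5 * r₁ + 1) * K₀ 64 8 * 9 * 64 ≤ 1)
    (hrenew : Real.exp 1 * 9 * 64 * K₀ 64 8 ^ 2 * (c.C3act * c.ε₁) ≤ E₀) (k : ℕ) (g : ℕ → ℝ) (i : ℕ)
    (X : (domSys (F.P K) M (k + 1)).Dom) (φ : CPair (F.P K) 𝔸) (Hc : ℂ → TDom 4 (domCount (F.P K) M (k + 1)) → ℂ)
    (Tt : (Z : TDom 4 (domCount (F.P K) M (k + 1))) →
      Finset (TDom 4 (L * domCount (F.P K) M (k + 1))) × Finset (TBond 4 M (L * domCount (F.P K) M (k + 1))) → ℂ → ℂ)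
    (O : Set ℂ) (hO : IsOpen O) (hdisc : ∀ t ∈ Ioc (0 : ℝ) γ, closedBall (t : ℂ) r ⊆ O)
    (hhol : ∀ Z : (domSys (F.P K) M (k + 1)).Dom, Z.1 ⊆ X.1 → DifferentiableOn ℂ (fun z => Hc z Z) O)
    (hdom : ∀ z ∈ O, ∀ Z : TDom 4 (domCount (F.P K) M (k + 1)), Z.1 ⊆ X.1 →
      ‖Hc z Z‖ ≤ ∑ t ∈ terms L M Z, ‖Tt Z t z‖)
    (h226 : ∀ z ∈ O, ∀ Z : TDom 4 (domCount (F.P K) M (k + 1)), Z.1 ⊆ X.1 → ∀ t ∈ terms L M Z,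
      ‖Tt Z t z‖ ≤ weight L M c Z a t * Real.exp (a₅ * ((Z.1).card : ℝ)))
    (hrepH : ∀ t ∈ Ioc (0 : ℝ) γ, Hc t = (S k).H (restrictPrefix k (Function.update g i t)) φ) :
    ∃ (Ec : ℂ → ℂ) (O : Set ℂ), IsOpen O ∧ (∀ t ∈ Ioc (0 : ℝ) γ, closedBall (t : ℂ) r ⊆ O) ∧ DifferentiableOn ℂ Ec O ∧
      (∀ z ∈ O, ‖Ec z‖ ≤ E₀ * Real.exp (-(κ * torusTreeLen X.1))) ∧
      (∀ t ∈ Ioc (0 : ℝ) γ, Ec t = termC S (k + 1) X (Function.update g i t) φ) :=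
  strip_succ_of_stripStepHRep F K S c hL hLc hN hA0 hr₁ hκ hrate hsmall hrenew k g i X φ Hc O hO hdisc hhol
    (hRep_of_termwise c (mul_nonneg hN.hα₆.le hN.hε₀) _ (fun Z t z => Tt Z t z) (fun Z z hz => hdom z hz.1 Z hz.2)
      (fun Z z hz t ht => h226 z hz.1 Z hz.2 t ht)) hrepH

/-! ## §3 The level-T one-step hypothesis along the induction, and the letters end to end -/

open Classical in
/-- **THE DISPLAYED LEVEL-T ONE-STEP HYPOTHESIS ⟹ MODULE 1's ONE-STEP OUTPUT HYPOTHESIS.**  `h226T`: for every step `k`, window history `g`,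
coupling `i ≤ k`, `X ∈ 𝐃_{k+1}`, `φ ∈ sp (k+1) X`, STRIP at all levels `≤ k` in coupling `i` (all domains, all configurations of the table — the
inductive assumption (1.18) on the strip) IMPLIES complexified activities `Hc` (holomorphic on an open `O ⊇` the discs, `Hc t = (S k).H (g|g_i:=t)|_{≤k}
φ`) dominated by complexified term values `Tt` over print's term set obeying (2.26) per term on the strip — [II] (2.15)–(2.26) READ ON THE STRIP,
DISPLAYED, asserted nowhere.  Under the socket's numerics at `ℓ = ½L`, `L ≥ 8`, S25's two located clauses at `A := C₃ε₁`, `R := (1−8δ)½Lκ` and the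
renewal, this is module 1's `hstep` (§2 pointwise). [cite: Balaban1988RG2Cluster, (2.26) p.17 and Lemma 3 p.20 (read on the strip)] -/
theorem stepOut_of_termwise226Strip [NeZero M] (S : ClusterTower (F.P K) 𝔸 M)
    (sp : (j : ℕ) → (domSys (F.P K) M j).Dom → Set (CPair (F.P K) 𝔸)) (c : B13.Consts) {L : ℕ} [NeZero L] (hL : 8 ≤ c.L)
    (hLc : c.L = L) {a a₂ a₂' a₅ Aabs : ℝ} (hN : Lemma3Numerics c M ((c.L : ℝ) / 2) a a₂ a₂' a₅ Aabs)
    {γ r E₀ κ r₁ : ℝ} (hA0 : 0 ≤ c.C3act * c.ε₁) (hr₁ : 0 ≤ r₁) (hκ : κ ≤ r₁)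
    (hrate : r₁ + 2 * (64 * Real.log 162) + 2 ≤ (1 - 8 * c.δ) * ((c.L : ℝ) / 2) * c.κ)
    (hsmall : c.C3act * c.ε₁ * Real.exp (5 * r₁ + 1) * K₀ 64 8 * 9 * 64 ≤ 1)
    (hrenew : Real.exp 1 * 9 * 64 * K₀ 64 8 ^ 2 * (c.C3act * c.ε₁) ≤ E₀)
    (h226T : ∀ (k : ℕ) (g : ℕ → ℝ), g ∈ Window γ → ∀ (i : ℕ), i < k + 1 → ∀ (X : (domSys (F.P K) M (k + 1)).Dom) (φ : CPair (F.P K) 𝔸),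
      φ ∈ sp (k + 1) X →
      (∀ (j : ℕ), j < k + 1 → ∀ (Y : (domSys (F.P K) M j).Dom) (ψ : CPair (F.P K) 𝔸), ψ ∈ sp j Y →
        ∃ (Ec : ℂ → ℂ) (O : Set ℂ), IsOpen O ∧ (∀ t ∈ Ioc (0 : ℝ) γ, closedBall (t : ℂ) r ⊆ O) ∧ DifferentiableOn ℂ Ec O ∧
          (∀ z ∈ O, ‖Ec z‖ ≤ E₀ * Real.exp (-(κ * torusTreeLen Y.1))) ∧
          (∀ t ∈ Ioc (0 : ℝ) γ, Ec t = termC S j Y (Function.update g i t) ψ)) →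
      ∃ (Hc : ℂ → TDom 4 (domCount (F.P K) M (k + 1)) → ℂ)
        (Tt : (Z : TDom 4 (domCount (F.P K) M (k + 1))) →
          Finset (TDom 4 (L * domCount (F.P K) M (k + 1))) × Finset (TBond 4 M (L * domCount (F.P K) M (k + 1))) → ℂ → ℂ)
        (O : Set ℂ), IsOpen O ∧ (∀ t ∈ Ioc (0 : ℝ) γ, closedBall (t : ℂ) r ⊆ O) ∧
        (∀ Z : (domSys (F.P K) M (k + 1)).Dom, Z.1 ⊆ X.1 → DifferentiableOn ℂ (fun z => Hc z Z) O) ∧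
        (∀ z ∈ O, ∀ Z : TDom 4 (domCount (F.P K) M (k + 1)), Z.1 ⊆ X.1 → ‖Hc z Z‖ ≤ ∑ t ∈ terms L M Z, ‖Tt Z t z‖) ∧
        (∀ z ∈ O, ∀ Z : TDom 4 (domCount (F.P K) M (k + 1)), Z.1 ⊆ X.1 → ∀ t ∈ terms L M Z,
          ‖Tt Z t z‖ ≤ weight L M c Z a t * Real.exp (a₅ * ((Z.1).card : ℝ))) ∧
        (∀ t ∈ Ioc (0 : ℝ) γ, Hc t = (S k).H (restrictPrefix k (Function.update g i t)) φ)) :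
    ∀ (k : ℕ) (g : ℕ → ℝ), g ∈ Window γ → ∀ (i : ℕ), i < k + 1 → ∀ (X : (domSys (F.P K) M (k + 1)).Dom) (φ : CPair (F.P K) 𝔸),
      φ ∈ sp (k + 1) X →
      (∀ (j : ℕ), j < k + 1 → ∀ (Y : (domSys (F.P K) M j).Dom) (ψ : CPair (F.P K) 𝔸), ψ ∈ sp j Y →
        ∃ (Ec : ℂ → ℂ) (O : Set ℂ), IsOpen O ∧ (∀ t ∈ Ioc (0 : ℝ) γ, closedBall (t : ℂ) r ⊆ O) ∧ DifferentiableOn ℂ Ec O ∧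
          (∀ z ∈ O, ‖Ec z‖ ≤ E₀ * Real.exp (-(κ * torusTreeLen Y.1))) ∧
          (∀ t ∈ Ioc (0 : ℝ) γ, Ec t = termC S j Y (Function.update g i t) ψ)) →
      ∃ (Ec : ℂ → ℂ) (O : Set ℂ), IsOpen O ∧ (∀ t ∈ Ioc (0 : ℝ) γ, closedBall (t : ℂ) r ⊆ O) ∧ DifferentiableOn ℂ Ec O ∧
        (∀ z ∈ O, ‖Ec z‖ ≤ E₀ * Real.exp (-(κ * torusTreeLen X.1))) ∧
        (∀ t ∈ Ioc (0 : ℝ) γ, Ec t = termC S (k + 1) X (Function.update g i t) φ) := by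
  intro k g hg i hi X φ hφ hIH
  obtain ⟨Hc, Tt, O, hO, hdisc, hhol, hdom, h226, hrepH⟩ := h226T k g hg i hi X φ hφ hIH
  exact strip_succ_of_termwise226Strip F K S c hL hLc hN hA0 hr₁ hκ hrate hsmall hrenew k g i X φ Hc Tt O hO hdisc hhol hdom h226 hrepH

open Classical in
/-- **END TO END, LEVEL T ⟹ STRIP AT EVERY LEVEL IN EVERY COUPLING** (module 1's induction `stripBound_termC_of_stepOut` on §3's producer; `0 ≤ E₀`
from the renewal). [folklore] -/
theorem stripBound_termC_of_termwise226Strip [NeZero M] (S : ClusterTower (F.P K) 𝔸 M)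
    (sp : (j : ℕ) → (domSys (F.P K) M j).Dom → Set (CPair (F.P K) 𝔸)) (c : B13.Consts) {L : ℕ} [NeZero L] (hL : 8 ≤ c.L)
    (hLc : c.L = L) {a a₂ a₂' a₅ Aabs : ℝ} (hN : Lemma3Numerics c M ((c.L : ℝ) / 2) a a₂ a₂' a₅ Aabs)
    {γ r E₀ κ r₁ : ℝ} (hr : 0 ≤ r) (hA0 : 0 ≤ c.C3act * c.ε₁) (hr₁ : 0 ≤ r₁) (hκ : κ ≤ r₁)
    (hrate : r₁ + 2 * (64 * Real.log 162) + 2 ≤ (1 - 8 * c.δ) * ((c.L : ℝ) / 2) * c.κ)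
    (hsmall : c.C3act * c.ε₁ * Real.exp (5 * r₁ + 1) * K₀ 64 8 * 9 * 64 ≤ 1)
    (hrenew : Real.exp 1 * 9 * 64 * K₀ 64 8 ^ 2 * (c.C3act * c.ε₁) ≤ E₀)
    (h226T : ∀ (k : ℕ) (g : ℕ → ℝ), g ∈ Window γ → ∀ (i : ℕ), i < k + 1 → ∀ (X : (domSys (F.P K) M (k + 1)).Dom) (φ : CPair (F.P K) 𝔸),
      φ ∈ sp (k + 1) X →
      (∀ (j : ℕ), j < k + 1 → ∀ (Y : (domSys (F.P K) M j).Dom) (ψ : CPair (F.P K) 𝔸), ψ ∈ sp j Y →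
        ∃ (Ec : ℂ → ℂ) (O : Set ℂ), IsOpen O ∧ (∀ t ∈ Ioc (0 : ℝ) γ, closedBall (t : ℂ) r ⊆ O) ∧ DifferentiableOn ℂ Ec O ∧
          (∀ z ∈ O, ‖Ec z‖ ≤ E₀ * Real.exp (-(κ * torusTreeLen Y.1))) ∧
          (∀ t ∈ Ioc (0 : ℝ) γ, Ec t = termC S j Y (Function.update g i t) ψ)) →
      ∃ (Hc : ℂ → TDom 4 (domCount (F.P K) M (k + 1)) → ℂ)
        (Tt : (Z : TDom 4 (domCount (F.P K) M (k + 1))) →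
          Finset (TDom 4 (L * domCount (F.P K) M (k + 1))) × Finset (TBond 4 M (L * domCount (F.P K) M (k + 1))) → ℂ → ℂ)
        (O : Set ℂ), IsOpen O ∧ (∀ t ∈ Ioc (0 : ℝ) γ, closedBall (t : ℂ) r ⊆ O) ∧
        (∀ Z : (domSys (F.P K) M (k + 1)).Dom, Z.1 ⊆ X.1 → DifferentiableOn ℂ (fun z => Hc z Z) O) ∧
        (∀ z ∈ O, ∀ Z : TDom 4 (domCount (F.P K) M (k + 1)), Z.1 ⊆ X.1 → ‖Hc z Z‖ ≤ ∑ t ∈ terms L M Z, ‖Tt Z t z‖) ∧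
        (∀ z ∈ O, ∀ Z : TDom 4 (domCount (F.P K) M (k + 1)), Z.1 ⊆ X.1 → ∀ t ∈ terms L M Z,
          ‖Tt Z t z‖ ≤ weight L M c Z a t * Real.exp (a₅ * ((Z.1).card : ℝ))) ∧
        (∀ t ∈ Ioc (0 : ℝ) γ, Hc t = (S k).H (restrictPrefix k (Function.update g i t)) φ)) :
    ∀ (j : ℕ) (g : ℕ → ℝ), g ∈ Window γ → ∀ (i : ℕ) (Y : (domSys (F.P K) M j).Dom) (ψ : CPair (F.P K) 𝔸), ψ ∈ sp j Y →
      ∃ (Ec : ℂ → ℂ) (O : Set ℂ), IsOpen O ∧ (∀ t ∈ Ioc (0 : ℝ) γ, closedBall (t : ℂ) r ⊆ O) ∧ DifferentiableOn ℂ Ec O ∧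
        (∀ z ∈ O, ‖Ec z‖ ≤ E₀ * Real.exp (-(κ * torusTreeLen Y.1))) ∧
        (∀ t ∈ Ioc (0 : ℝ) γ, Ec t = termC S j Y (Function.update g i t) ψ) :=
  have hM : 0 ≤ Real.exp 1 * 9 * 64 * K₀ 64 8 ^ 2 * (c.C3act * c.ε₁) := by positivity
  stripBound_termC_of_stepOut S sp hr (le_trans hM hrenew)
    (stepOut_of_termwise226Strip F K S sp c hL hLc hN hA0 hr₁ hκ hrate hsmall hrenew h226T)

open Classical in
/-- **END TO END, LEVEL T ⟹ (1.18) ONE RUN** (`W1.TermBound118 S (Window γ) sp E₀ κ`; module 1's `termBound118_of_stripBound`).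
[cite: Balaban1987RG1, (1.18) p.263] -/
theorem termBound118_of_termwise226Strip [NeZero M] (S : ClusterTower (F.P K) 𝔸 M)
    (sp : (j : ℕ) → (domSys (F.P K) M j).Dom → Set (CPair (F.P K) 𝔸)) (c : B13.Consts) {L : ℕ} [NeZero L] (hL : 8 ≤ c.L)
    (hLc : c.L = L) {a a₂ a₂' a₅ Aabs : ℝ} (hN : Lemma3Numerics c M ((c.L : ℝ) / 2) a a₂ a₂' a₅ Aabs)
    {γ r E₀ κ r₁ : ℝ} (hr : 0 ≤ r) (hA0 : 0 ≤ c.C3act * c.ε₁) (hr₁ : 0 ≤ r₁) (hκ : κ ≤ r₁)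
    (hrate : r₁ + 2 * (64 * Real.log 162) + 2 ≤ (1 - 8 * c.δ) * ((c.L : ℝ) / 2) * c.κ)
    (hsmall : c.C3act * c.ε₁ * Real.exp (5 * r₁ + 1) * K₀ 64 8 * 9 * 64 ≤ 1)
    (hrenew : Real.exp 1 * 9 * 64 * K₀ 64 8 ^ 2 * (c.C3act * c.ε₁) ≤ E₀)
    (h226T : ∀ (k : ℕ) (g : ℕ → ℝ), g ∈ Window γ → ∀ (i : ℕ), i < k + 1 → ∀ (X : (domSys (F.P K) M (k + 1)).Dom) (φ : CPair (F.P K) 𝔸),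
      φ ∈ sp (k + 1) X →
      (∀ (j : ℕ), j < k + 1 → ∀ (Y : (domSys (F.P K) M j).Dom) (ψ : CPair (F.P K) 𝔸), ψ ∈ sp j Y →
        ∃ (Ec : ℂ → ℂ) (O : Set ℂ), IsOpen O ∧ (∀ t ∈ Ioc (0 : ℝ) γ, closedBall (t : ℂ) r ⊆ O) ∧ DifferentiableOn ℂ Ec O ∧
          (∀ z ∈ O, ‖Ec z‖ ≤ E₀ * Real.exp (-(κ * torusTreeLen Y.1))) ∧
          (∀ t ∈ Ioc (0 : ℝ) γ, Ec t = termC S j Y (Function.update g i t) ψ)) →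
      ∃ (Hc : ℂ → TDom 4 (domCount (F.P K) M (k + 1)) → ℂ)
        (Tt : (Z : TDom 4 (domCount (F.P K) M (k + 1))) →
          Finset (TDom 4 (L * domCount (F.P K) M (k + 1))) × Finset (TBond 4 M (L * domCount (F.P K) M (k + 1))) → ℂ → ℂ)
        (O : Set ℂ), IsOpen O ∧ (∀ t ∈ Ioc (0 : ℝ) γ, closedBall (t : ℂ) r ⊆ O) ∧
        (∀ Z : (domSys (F.P K) M (k + 1)).Dom, Z.1 ⊆ X.1 → DifferentiableOn ℂ (fun z => Hc z Z) O) ∧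
        (∀ z ∈ O, ∀ Z : TDom 4 (domCount (F.P K) M (k + 1)), Z.1 ⊆ X.1 → ‖Hc z Z‖ ≤ ∑ t ∈ terms L M Z, ‖Tt Z t z‖) ∧
        (∀ z ∈ O, ∀ Z : TDom 4 (domCount (F.P K) M (k + 1)), Z.1 ⊆ X.1 → ∀ t ∈ terms L M Z,
          ‖Tt Z t z‖ ≤ weight L M c Z a t * Real.exp (a₅ * ((Z.1).card : ℝ))) ∧
        (∀ t ∈ Ioc (0 : ℝ) γ, Hc t = (S k).H (restrictPrefix k (Function.update g i t)) φ)) :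
    TermBound118 S (Window γ) sp E₀ κ :=
  termBound118_of_stripBound S sp hr
    (stripBound_termC_of_termwise226Strip F K S sp c hL hLc hN hr hA0 hr₁ hκ hrate hsmall hrenew h226T)

open Classical in
/-- **END TO END, LEVEL T ⟹ ROAD 3's (A) LETTER FOR THE W1 FUNCTIONAL** (readings inside the spaces; module 2's `supLetter_functionalOn_of_stripBound`):
the `hA` clause of `YMDAG.N22.n22At_of_oscAnalytic` with `M := E₀`, `μ := 1`. [folklore] -/
theorem supLetter_functionalOn_of_termwise226Strip [NeZero M] (S : ClusterTower (F.P K) 𝔸 M) (p : RunPairing) {B : Type}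
    (emb : B → CPair (F.P K) 𝔸) (sp : (j : ℕ) → (domSys (F.P K) M j).Dom → Set (CPair (F.P K) 𝔸))
    (hsp : ∀ (j : ℕ) (U : B) (Y : (domSys (F.P K) M j).Dom), emb U ∈ sp j Y) (c : B13.Consts) {L : ℕ} [NeZero L]
    (hL : 8 ≤ c.L) (hLc : c.L = L) {a a₂ a₂' a₅ Aabs : ℝ} (hN : Lemma3Numerics c M ((c.L : ℝ) / 2) a a₂ a₂' a₅ Aabs)
    {γ r E₀ κ r₁ : ℝ} (hr : 0 ≤ r) (hA0 : 0 ≤ c.C3act * c.ε₁) (hr₁ : 0 ≤ r₁) (hκ : κ ≤ r₁)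
    (hrate : r₁ + 2 * (64 * Real.log 162) + 2 ≤ (1 - 8 * c.δ) * ((c.L : ℝ) / 2) * c.κ)
    (hsmall : c.C3act * c.ε₁ * Real.exp (5 * r₁ + 1) * K₀ 64 8 * 9 * 64 ≤ 1)
    (hrenew : Real.exp 1 * 9 * 64 * K₀ 64 8 ^ 2 * (c.C3act * c.ε₁) ≤ E₀)
    (h226T : ∀ (k : ℕ) (g : ℕ → ℝ), g ∈ Window γ → ∀ (i : ℕ), i < k + 1 → ∀ (X : (domSys (F.P K) M (k + 1)).Dom) (φ : CPair (F.P K) 𝔸),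
      φ ∈ sp (k + 1) X →
      (∀ (j : ℕ), j < k + 1 → ∀ (Y : (domSys (F.P K) M j).Dom) (ψ : CPair (F.P K) 𝔸), ψ ∈ sp j Y →
        ∃ (Ec : ℂ → ℂ) (O : Set ℂ), IsOpen O ∧ (∀ t ∈ Ioc (0 : ℝ) γ, closedBall (t : ℂ) r ⊆ O) ∧ DifferentiableOn ℂ Ec O ∧
          (∀ z ∈ O, ‖Ec z‖ ≤ E₀ * Real.exp (-(κ * torusTreeLen Y.1))) ∧
          (∀ t ∈ Ioc (0 : ℝ) γ, Ec t = termC S j Y (Function.update g i t) ψ)) →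
      ∃ (Hc : ℂ → TDom 4 (domCount (F.P K) M (k + 1)) → ℂ)
        (Tt : (Z : TDom 4 (domCount (F.P K) M (k + 1))) →
          Finset (TDom 4 (L * domCount (F.P K) M (k + 1))) × Finset (TBond 4 M (L * domCount (F.P K) M (k + 1))) → ℂ → ℂ)
        (O : Set ℂ), IsOpen O ∧ (∀ t ∈ Ioc (0 : ℝ) γ, closedBall (t : ℂ) r ⊆ O) ∧
        (∀ Z : (domSys (F.P K) M (k + 1)).Dom, Z.1 ⊆ X.1 → DifferentiableOn ℂ (fun z => Hc z Z) O) ∧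
        (∀ z ∈ O, ∀ Z : TDom 4 (domCount (F.P K) M (k + 1)), Z.1 ⊆ X.1 → ‖Hc z Z‖ ≤ ∑ t ∈ terms L M Z, ‖Tt Z t z‖) ∧
        (∀ z ∈ O, ∀ Z : TDom 4 (domCount (F.P K) M (k + 1)), Z.1 ⊆ X.1 → ∀ t ∈ terms L M Z,
          ‖Tt Z t z‖ ≤ weight L M c Z a t * Real.exp (a₅ * ((Z.1).card : ℝ))) ∧
        (∀ t ∈ Ioc (0 : ℝ) γ, Hc t = (S k).H (restrictPrefix k (Function.update g i t)) φ)) :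
    ∀ g ∈ Window γ, ∀ (U : B) (X : (histCarriers (F.P K) M p).Dom) (i : ℕ), i < (histCarriers (F.P K) M p).scale X →
      ∃ (Fz : ℂ → ℂ) (Dset : Set ℂ), DifferentiableOn ℂ Fz Dset ∧
        (∀ z ∈ Dset, ‖Fz z‖ ≤ E₀ * 1 ^ ((histCarriers (F.P K) M p).scale X - 1 - i) *
          Real.exp (-(κ * (histCarriers (F.P K) M p).d X))) ∧
        (∀ t ∈ Ioc (0 : ℝ) γ, closedBall (t : ℂ) r ⊆ Dset) ∧
        (∀ t ∈ Ioc (0 : ℝ) γ, Fz t = (functionalOn S p emb (Function.update g i t) U X : ℂ)) :=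
  supLetter_functionalOn_of_stripBound S p emb sp hsp
    (stripBound_termC_of_termwise226Strip F K S sp c hL hLc hN hr hA0 hr₁ hκ hrate hsmall hrenew h226T)

/-! ## §4 Non-vacuity of the level-T hypothesis (A5 rider) -/

open Classical in
/-- **NON-VACUITY OF THE LEVEL-T HYPOTHESIS (A5 rider).**  The termless model tower (`idx Z = ∅`, `H ≡ 0`) carries `h226T` with `Hc ≡ 0`, `Tt ≡ 0`,
`O = ℂ` (domination `0 ≤ Σ 0`; (2.26) per term `0 ≤ weight·e^{a₅|Z|}` by `weight_nonneg`, `0 ≤ α₆ε₂`), whatever the antecedent — so §3 is not a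
vacuous implication.  Model tower, NOT NODE 00's (junk-shaped per ref-H WATCH-W1-DEGENERATE). [folklore] -/
theorem termwise226Strip_termlessTower [NeZero M] {P : Params} (sp : (j : ℕ) → (domSys P M j).Dom → Set (CPair P 𝔸)) (c : B13.Consts)
    {L : ℕ} [NeZero L] (hA : 0 ≤ c.α₆ * c.eps2) {γ r E₀ κ a a₅ : ℝ} :
    ∀ (k : ℕ) (g : ℕ → ℝ), g ∈ Window γ → ∀ (i : ℕ), i < k + 1 → ∀ (X : (domSys P M (k + 1)).Dom) (φ : CPair P 𝔸), φ ∈ sp (k + 1) X →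
      (∀ (j : ℕ), j < k + 1 → ∀ (Y : (domSys P M j).Dom) (ψ : CPair P 𝔸), ψ ∈ sp j Y →
        ∃ (Ec : ℂ → ℂ) (O : Set ℂ), IsOpen O ∧ (∀ t ∈ Ioc (0 : ℝ) γ, closedBall (t : ℂ) r ⊆ O) ∧ DifferentiableOn ℂ Ec O ∧
          (∀ z ∈ O, ‖Ec z‖ ≤ E₀ * Real.exp (-(κ * torusTreeLen Y.1))) ∧
          (∀ t ∈ Ioc (0 : ℝ) γ, Ec t =
            termC (fun k => (⟨PUnit, fun _ => ∅, fun _ _ _ => 0⟩ : ClusterStep P 𝔸 M k)) j Y (Function.update g i t) ψ)) →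
      ∃ (Hc : ℂ → TDom P.d (domCount P M (k + 1)) → ℂ)
        (Tt : (Z : TDom P.d (domCount P M (k + 1))) →
          Finset (TDom P.d (L * domCount P M (k + 1))) × Finset (TBond P.d M (L * domCount P M (k + 1))) → ℂ → ℂ)
        (O : Set ℂ), IsOpen O ∧ (∀ t ∈ Ioc (0 : ℝ) γ, closedBall (t : ℂ) r ⊆ O) ∧
        (∀ Z : (domSys P M (k + 1)).Dom, Z.1 ⊆ X.1 → DifferentiableOn ℂ (fun z => Hc z Z) O) ∧
        (∀ z ∈ O, ∀ Z : TDom P.d (domCount P M (k + 1)), Z.1 ⊆ X.1 → ‖Hc z Z‖ ≤ ∑ t ∈ terms L M Z, ‖Tt Z t z‖) ∧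
        (∀ z ∈ O, ∀ Z : TDom P.d (domCount P M (k + 1)), Z.1 ⊆ X.1 → ∀ t ∈ terms L M Z,
          ‖Tt Z t z‖ ≤ weight L M c Z a t * Real.exp (a₅ * ((Z.1).card : ℝ))) ∧
        (∀ t ∈ Ioc (0 : ℝ) γ, Hc t =
          ((fun k => (⟨PUnit, fun _ => ∅, fun _ _ _ => 0⟩ : ClusterStep P 𝔸 M k)) k).H (restrictPrefix k (Function.update g i t)) φ) := by
  intro k g _ i _ X φ _ _
  refine ⟨fun _ _ => 0, fun _ _ _ => 0, Set.univ, isOpen_univ, fun t _ => subset_univ _, fun Z _ => differentiableOn_const 0,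
    fun z _ Z _ => ?_, fun z _ Z _ t _ => ?_, fun t _ => ?_⟩
  · simp only [norm_zero, Finset.sum_const_zero, le_refl]
  · rw [norm_zero]
    exact mul_nonneg (weight_nonneg (L := L) (M := M) c Z a hA t) (Real.exp_nonneg _)
  · funext Z
    simp [ClusterStep.H]

end YMDAG.N22.W1

end
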